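import Summits.BirchSwinnertonDyer.Rank1Residual.X1.PadicSigmaThreeIsogenyKohel
import Summits.BirchSwinnertonDyer.Rank1Residual.X1.PadicSigmaThreeFormalIsogeny
import HarnessLib

/-!
# The formal `3`-isogeny of the ordinary `a₂`-family: the parameter `T ≡ t³`, the unit series
# `u ≡ 1`, `X'(T) = ev₃(U)·u²`, `ω'(T)dT = πω`, and Blakestad–Grant's Prop. 13 hypothesis in `ρ`-form
# (module M3b of the x1a design for the Mazur–Tate sigma function at `p = 3`)

HONEST FRAMING (cell `b2b-bsdres`, run/shared/lean/b2b/bsd-rank1-residual/, verbatim in every file):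
the goal of the cell is to DELETE the COMBINATION-SHAPED residual classes of the Birch–Swinnerton-Dyer
formula for ALL analytic-rank `≤ 1` elliptic curves over `ℚ` — "full BSD formula for every rank `≤ 1`
curve in class `C`" assembled STRICTLY from published theorems — so that the rank-`≤ 1` remainder
becomes exactly the CONSTRUCTION-SHAPED classes, which are TYPED (missing-input `Prop`s), NOT
attempted. This is not "finishing BSD". CLASS-OWNERS.md row "X1 (r = 1)": research route; NO CLAIM
BEYOND STATED CLASSES; nothing is booked by this file; no preprint enters; no named fact.

Unit `b2b-bsdres-x1a` (X1 prover A, gen 20). WHAT. For a chart `d : Chart R` (`X1/PadicSigmaThreeChart`)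
with its curve `𝓔`, quotient model `𝓔'` and the polynomial data `(φ, U, M) = (kernelPoly, xNum, yNum)` of
the canonical `3`-isogeny `ψ : 𝓔 → 𝓔'` (`X1/PadicSigmaThreeIsogeny`, `…IsogenyKohel`), this file defines
the two power series of Blakestad–Grant's Lemma 12 — the unit `u = 𝒰/(Xℳ)` (`unitSeries`, the tree's
`veluFormalUnit U M 3 1`) and the parameter `T = t'∘ψ = ℓ₀⁻¹·t·Φ·u`, `ℓ₀ = φ(0) = -Y` (`isogParam`) — and
proves, by the bridge lemmas of `X1/PadicSigmaThreeFormalIsogeny.lean` and the tree's chart uniqueness: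
* over ANY ring: `T(0) = 0`, `[t¹]T = π`, **`T ≡ t³ (mod 3)`** (`coeff_isogParam_sub_mem`), `u(0) = 1`,
  `[t¹]u = 0`, **`u ≡ 1 (mod 3)`** (`coeff_succ_unitSeries_mem`); the cleared Weierstrass equation of the
  image point `P = ev₃(U)·u²` on `𝓔'` (`sq_imagePoint`) and hence **`X'(T) = P`**
  (`formalXMulSq_isogCurve_subst`, Silverman IV.1.1 uniqueness = the tree's `formalXMulSq_subst_eq_of_sq_eq`);
* over a ring in which `3` is also invertible: `T = π·t·ev₁(X - x(P))·u` (`isogParam_eq`),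
  **`ω'(T)dT = π·ω`** (`formalInvDiff_isogCurve_subst`), the Vélu + Lemma 10 identity for `X'(T)` in the
  pole-free form of the tree's `formalXReg_rel_of_velu` (`formalXMulSq_isogCurve_subst_eq_logForm`, via
  `kohel` and the tree's `clearedEval_logForm`), and **Blakestad–Grant's Prop. 13 hypothesis in `ρ`-form**:
  `(π²ρ'(T) - 3ρ + T₀)u² = uD²u - (Du)²` (`formalXReg_rel`).
So after this file the `p = 3` sigma integrality needs exactly the universal ring `ℤ[Y, A₄, A₆][1/Y]^₃`
with its Frobenius lift `(Y, A₄, A₆) ↦ (Y', a₄', a₆')` and Thm 2 / Prop. 13(a) / Dwork over it (modules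
M2, M4 of HOME/b2b-bsdres-x1a/gen20/A34-P3-DESIGN.md), all of whose HYPOTHESES about the isogeny are
the theorems of this file.

References: C. Blakestad, D. Grant, J. Number Theory 249 (2023) 348–376, Prop. 7(c), Lemmas 10–12,
Prop. 13 [BlakestadGrant2023]; J. Vélu, C. R. Acad. Sci. Paris 273 (1971) [Velu1971]; J. H. Silverman,
AEC (2009) IV.1.1 [SilvermanAEC2009]. Proof structure adapted from the tree's
`PadicSigmaVeluKernelBridgeProofs.coeff_exp_sigmaExpArg_universalCurve_mem_of_veluKernelData` (steps S2–S6).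

Two definitions with bodies (`unitSeries`, `isogParam`); theorems only otherwise; no named fact, no
`sorry`; standard axioms.
-/

noncomputable section

open PowerSeries Literature.NumberTheory.EllipticCurves
open scoped Polynomial

namespace Summit.BirchSwinnertonDyer.Rank1Residual.X1.PadicSigmaThree

namespace Chart

variable {R : Type*} [CommRing R] (d : Chart R)

/-! ## The two series -/

/-- **Blakestad–Grant's unit series `u = 𝒰/(X·ℳ)`** of the canonical `3`-isogeny (`𝒰 = ev₃(U)`,
`ℳ = ev₃(M)`, `X = t²x(t)`): the tree's `veluFormalUnit U M 3 1`. [cite: BlakestadGrant2023, Lemma 12] -/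
def unitSeries : R⟦X⟧ := d.curve.veluFormalUnit d.xNum d.yNum 3 1

/-- **The parameter of the isogeny `T = t'∘ψ = ℓ₀⁻¹·t·Φ·u`**, `ℓ₀ = φ(0) = -Y` (`Φ = ev₁(φ)`): the formal
group homomorphism `𝓔̂ → 𝓔̂'` induced by `ψ` in the coordinates of `𝓔' = isogCurve` (`x' = ℓ₀²·U/φ²`).
[cite: BlakestadGrant2023, Lemma 12] -/
def isogParam : R⟦X⟧ := C (-d.yi) * d.curve.veluFormalIsog d.kernelPoly d.xNum d.yNum 3 1

/-- `u(0) = 1`. [folklore] -/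
theorem constantCoeff_unitSeries : constantCoeff d.unitSeries = 1 := by
  rw [unitSeries, WeierstrassCurve.veluFormalUnit, map_mul, d.curve.constantCoeff_clearedEval d.natDegree_xNum_le,
    coeff_xNum_three, one_mul, constantCoeff_invOfUnit, inv_one, Units.val_one]

/-- **`u ≡ 1 (mod 3)`**: every positive-degree coefficient of `u` lies in `3R` (`U ≡ X³`, `M ≡ f`).
[cite: BlakestadGrant2023, Lemma 12] -/
theorem coeff_succ_unitSeries_mem (i : ℕ) : coeff (i + 1) d.unitSeries ∈ Ideal.span {(3 : R)} := by
  have h := map_veluFormalUnit_sub_one_of_isCharNeTwoNF (W := d.curve) (p := 3) (n := 1) (by norm_num)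
    d.natDegree_xNum_le (fun i => by exact_mod_cast d.dvd_coeff_xNum_sub i) d.natDegree_yNum_le d.coeff_yNum_three
    (fun i => by exact_mod_cast d.dvd_coeff_yNum_sub i)
  have h1 : Ideal.Quotient.mk (Ideal.span {((3 : ℕ) : R)}) (coeff (i + 1) (d.unitSeries - 1)) = 0 := by
    rw [← coeff_map, unitSeries, h]; rfl
  rw [map_sub, coeff_one, if_neg (Nat.succ_ne_zero i), sub_zero, Nat.cast_ofNat] at h1
  exact Ideal.Quotient.eq_zero_iff_mem.mp h1

/-- `[t¹]u = 0` (parity: `a₁ = 0`). [folklore] -/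
theorem coeff_one_unitSeries : coeff 1 d.unitSeries = 0 := by
  set Q := d.curve.formalXMulSq * d.curve.clearedEval (3 * 1) d.yNum with hQ
  have hQ0 : constantCoeff Q = 1 :=
    WeierstrassCurve.constantCoeff_formalXMulSq_mul_clearedEval d.natDegree_yNum_le d.coeff_yNum_three
  have hev1 : ∀ {g : R[X]} {e : ℕ}, g.natDegree ≤ e → coeff 1 (d.curve.clearedEval e g) = 0 := by
    intro g e hg
    rw [d.curve.clearedEval_eq_sum hg, map_sum]
    refine Finset.sum_eq_zero fun k hk => ?_
    have hk' : k ≤ e := Nat.lt_succ_iff.mp (Finset.mem_range.mp hk)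
    rw [coeff_C_mul]
    rcases Nat.eq_or_lt_of_le hk' with rfl | hlt
    · rw [Nat.sub_self, mul_zero, pow_zero, mul_one,
        coeff_one_pow_eq_zero (by rw [d.curve.coeff_one_formalXMulSq, curve_a₁, neg_zero]), mul_zero]
    · rw [mul_comm (d.curve.formalXMulSq ^ k), coeff_X_pow_mul', if_neg (by omega), mul_zero]
  have hQ1 : coeff 1 Q = 0 := by
    rw [hQ, coeff_mul, Finset.Nat.antidiagonal_succ, Finset.sum_cons, Finset.Nat.antidiagonal_zero, Finset.map_singleton,
      Finset.sum_singleton]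
    simp only [Function.Embedding.coe_prodMap, Function.Embedding.coeFn_mk, Prod.map_apply, Nat.succ_eq_add_one,
      zero_add, Function.Embedding.refl_apply, coeff_zero_eq_constantCoeff_apply]
    rw [hev1 d.natDegree_yNum_le, d.curve.coeff_one_formalXMulSq, curve_a₁, neg_zero, zero_mul, add_zero, mul_zero]
  set v := Q.invOfUnit 1 with hv
  have hQv : Q * v = 1 := mul_invOfUnit Q 1 (by rw [hQ0, Units.val_one])
  have hv1 : coeff 1 v = 0 := by
    have h := congrArg (coeff 1) hQv
    rw [coeff_mul, Finset.Nat.antidiagonal_succ, Finset.sum_cons, Finset.Nat.antidiagonal_zero, Finset.map_singleton,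
      Finset.sum_singleton, coeff_one, if_neg one_ne_zero] at h
    simp only [Function.Embedding.coe_prodMap, Function.Embedding.coeFn_mk, Prod.map_apply, Nat.succ_eq_add_one,
      zero_add, Function.Embedding.refl_apply, coeff_zero_eq_constantCoeff_apply, hQ0, one_mul, hQ1, zero_mul,
      add_zero] at h
    exact h
  rw [unitSeries, WeierstrassCurve.veluFormalUnit, ← hQ, ← hv, coeff_mul, Finset.Nat.antidiagonal_succ, Finset.sum_cons,
    Finset.Nat.antidiagonal_zero, Finset.map_singleton, Finset.sum_singleton]
  simp only [Function.Embedding.coe_prodMap, Function.Embedding.coeFn_mk, Prod.map_apply, Nat.succ_eq_add_one,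
    zero_add, Function.Embedding.refl_apply, coeff_zero_eq_constantCoeff_apply, hv1, mul_zero,
    hev1 d.natDegree_xNum_le, zero_mul, add_zero]

/-- `T(0) = 0`. [folklore] -/
theorem constantCoeff_isogParam : constantCoeff d.isogParam = 0 := by
  rw [isogParam, map_mul, WeierstrassCurve.constantCoeff_veluFormalIsog, mul_zero]

/-- `[t¹]T = π` (`ψ^*ω' = πω`). [cite: BlakestadGrant2023, Prop. 7] -/
theorem coeff_one_isogParam : coeff 1 d.isogParam = d.piConst := by
  rw [isogParam, coeff_C_mul, WeierstrassCurve.coeff_one_veluFormalIsog d.natDegree_kernelPoly_le d.natDegree_xNum_le,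
    coeff_kernelPoly_one, coeff_xNum_three, piConst]
  ring

/-- **`T ≡ t³ (mod 3)`**: `[tⁱ]T - δ_{i,3} ∈ 3R` for every `i` (`t₃ ≡ ℓ₀t³`, `ℓ₀ = -Y`, `T = -Y⁻¹t₃`).
[cite: BlakestadGrant2023, Prop. 7] -/
theorem coeff_isogParam_sub_mem (i : ℕ) :
    coeff i d.isogParam - (if i = 3 then 1 else 0) ∈ Ideal.span {(3 : R)} := by
  have h := map_veluFormalIsog_sub_of_isCharNeTwoNF (W := d.curve) (p := 3) (n := 1) (by norm_num)
    d.natDegree_kernelPoly_le (fun i hi => by exact_mod_cast d.dvd_coeff_kernelPoly i hi) d.natDegree_xNum_le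
    (fun i => by exact_mod_cast d.dvd_coeff_xNum_sub i) d.natDegree_yNum_le d.coeff_yNum_three
    (fun i => by exact_mod_cast d.dvd_coeff_yNum_sub i)
  have h1 : Ideal.Quotient.mk (Ideal.span {((3 : ℕ) : R)})
      (coeff i (d.curve.veluFormalIsog d.kernelPoly d.xNum d.yNum 3 1 - C (d.kernelPoly.coeff 0) * X ^ 3)) = 0 := by
    rw [← coeff_map, h]; rfl
  rw [Nat.cast_ofNat] at h1
  have hi := Ideal.Quotient.eq_zero_iff_mem.mp h1
  have e : coeff i d.isogParam - (if i = 3 then 1 else 0) =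
      -d.yi * coeff i (d.curve.veluFormalIsog d.kernelPoly d.xNum d.yNum 3 1 - C (d.kernelPoly.coeff 0) * X ^ 3) := by
    rw [isogParam, coeff_C_mul, map_sub, coeff_C_mul, coeff_X_pow, coeff_kernelPoly_zero]
    split_ifs
    · linear_combination d.Y_mul_yi
    · ring
  rw [e]; exact Ideal.mul_mem_left _ _ hi

/-! ## Base change -/

section Map

variable {S : Type*} [CommRing S] (φ : R →+* S)

/-- `invOfUnit 1` commutes with ring maps for series with constant term `1`. [folklore] -/
theorem map_invOfUnit_one {F : R⟦X⟧} (hF : constantCoeff F = 1) :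
    PowerSeries.map φ (F.invOfUnit 1) = (PowerSeries.map φ F).invOfUnit 1 := by
  have hF' : constantCoeff (PowerSeries.map φ F) = 1 := by
    rw [← coeff_zero_eq_constantCoeff_apply, coeff_map, coeff_zero_eq_constantCoeff_apply, hF, map_one]
  have h1 : PowerSeries.map φ F * PowerSeries.map φ (F.invOfUnit 1) = 1 := by
    rw [← map_mul, mul_invOfUnit F 1 (by rw [hF, Units.val_one]), map_one]
  have h2 : PowerSeries.map φ F * (PowerSeries.map φ F).invOfUnit 1 = 1 :=
    mul_invOfUnit _ 1 (by rw [hF', Units.val_one])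
  have hu : IsUnit (PowerSeries.map φ F) := IsUnit.of_mul_eq_one _ h2
  exact hu.mul_left_cancel (h1.trans h2.symm)

/-- `u` commutes with base change. [folklore] -/
theorem unitSeries_map : (d.map φ).unitSeries = PowerSeries.map φ d.unitSeries := by
  rw [unitSeries, unitSeries, WeierstrassCurve.veluFormalUnit, WeierstrassCurve.veluFormalUnit, curve_map, xNum_map,
    yNum_map, ← WeierstrassCurve.map_clearedEval _ φ d.natDegree_xNum_le, ← WeierstrassCurve.map_clearedEval _ φ d.natDegree_yNum_le,
    ← WeierstrassCurve.map_formalXMulSq, map_mul, ← map_mul,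
    map_invOfUnit_one φ (WeierstrassCurve.constantCoeff_formalXMulSq_mul_clearedEval d.natDegree_yNum_le d.coeff_yNum_three)]

/-- `T` commutes with base change. [folklore] -/
theorem isogParam_map : (d.map φ).isogParam = PowerSeries.map φ d.isogParam := by
  rw [isogParam, isogParam, WeierstrassCurve.veluFormalIsog, WeierstrassCurve.veluFormalIsog, ← unitSeries, ← unitSeries,
    unitSeries_map, curve_map, kernelPoly_map, ← WeierstrassCurve.map_clearedEval _ φ d.natDegree_kernelPoly_le, map_yi,
    map_mul, map_mul, map_mul, map_C, map_X]
  simp only [map_neg, neg_mul, mul_assoc]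

end Map

/-! ## The image point `P = ev₃(U)·u²` and `X'(T) = P` -/

/-- **The cleared Weierstrass equation of the image of the formal point on `𝓔'`**:
`P² = P³ + a₂'T²P² + a₄'T⁴P + a₆'T⁶` for `P = ev₃(U)·u²`, `T = isogParam` — from `weierstrass` by
`sq_velu_image_of_isCharNeTwoNF` (`(a₂'/Y²)·t₃² = a₂'·T²` etc., `T = -Y⁻¹t₃`).
[cite: BlakestadGrant2023, Prop. 7] -/
theorem sq_imagePoint :
    (d.curve.clearedEval 3 d.xNum * d.unitSeries ^ 2) ^ 2 =
      (d.curve.clearedEval 3 d.xNum * d.unitSeries ^ 2) ^ 3 +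
        C d.isogCurve.a₁ * d.isogParam * (d.curve.clearedEval 3 d.xNum * d.unitSeries ^ 2) ^ 2 +
        C d.isogCurve.a₂ * d.isogParam ^ 2 * (d.curve.clearedEval 3 d.xNum * d.unitSeries ^ 2) ^ 2 +
        C d.isogCurve.a₃ * d.isogParam ^ 3 * (d.curve.clearedEval 3 d.xNum * d.unitSeries ^ 2) +
        C d.isogCurve.a₄ * d.isogParam ^ 4 * (d.curve.clearedEval 3 d.xNum * d.unitSeries ^ 2) +
        C d.isogCurve.a₆ * d.isogParam ^ 6 := by
  have h := sq_velu_image_of_isCharNeTwoNF (W := d.curve) (p := 3) (n := 1) (by norm_num) d.natDegree_kernelPoly_le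
    d.natDegree_xNum_le d.natDegree_yNum_le d.coeff_yNum_three d.weierstrass
  rw [isogCurve_a₁, isogCurve_a₂, isogCurve_a₃, isogCurve_a₄, isogCurve_a₆, isogParam, map_zero, zero_mul, zero_mul,
    add_zero, zero_mul, zero_mul, add_zero]
  rw [← unitSeries] at h
  simp only [map_mul, map_pow, map_neg] at h ⊢
  linear_combination h

/-- **`X'(T) = ev₃(U)·u²`**: the `x`-coordinate series of `𝓔'` read through the isogeny parameter is the
image point (uniqueness of the formal chart, Silverman IV.1.1 / tree `formalXMulSq_subst_eq_of_sq_eq`).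
[cite: SilvermanAEC2009, IV.1.1] -/
theorem formalXMulSq_isogCurve_subst :
    d.isogCurve.formalXMulSq.subst d.isogParam = d.curve.clearedEval 3 d.xNum * d.unitSeries ^ 2 :=
  d.isogCurve.formalXMulSq_subst_eq_of_sq_eq d.constantCoeff_isogParam
    (by rw [map_mul, map_pow, d.constantCoeff_unitSeries, one_pow, mul_one,
      d.curve.constantCoeff_clearedEval d.natDegree_xNum_le, coeff_xNum_three]) d.sq_imagePoint

/-! ## Over a ring in which `3` is invertible: `ω'(T)dT = πω` and Prop. 13's hypothesis -/

section Third

variable {th : R} (h3 : (3 : R) * th = 1)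
include h3

/-- `T = π·t·ev₁(X - x(P))·u` (`Φ = ev₁(φ) = 3·ev₁(X - x(P))`, `-Y⁻¹·3 = π`). [cite: BlakestadGrant2023, Lemma 12] -/
theorem isogParam_eq :
    d.isogParam = C d.piConst * X * d.curve.clearedEval 1 (Polynomial.X - Polynomial.C (d.Y * th)) * d.unitSeries := by
  rw [isogParam, WeierstrassCurve.veluFormalIsog, ← unitSeries, d.kernelPoly_eq_mul h3, WeierstrassCurve.clearedEval_C_mul,
    piConst, show C (-3 * d.yi) = C (-d.yi) * (C 3 : R⟦X⟧) by rw [← map_mul]; ring_nf]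
  ring

/-- **`ω'(T)dT = π·ω`** (`ψ^*ω' = πω`): `W'(T)·T^• = π·W` for the invariant differentials `ω = W(t)dt` of `𝓔`
and `ω' = W'(t')dt'` of `𝓔'`. From `formalEta_mul_velu_image_scaled` (`η(TP^• - 2PT^•) = -2πP`) and the chart
lemma `formalEta_subst_mul_eq` (`η'(T)(TP^• - 2PT^•) = -2PT^•`), dividing by the unit `TP^• - 2PT^•`
(constant term `-2π`; `2`, `π` units). [cite: BlakestadGrant2023, Prop. 13] -/
theorem formalInvDiff_isogCurve_subst :
    d.isogCurve.formalInvDiff.subst d.isogParam * d⁄dX R d.isogParam = C d.piConst * d.curve.formalInvDiff := by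
  set T := d.isogParam with hT
  set P := d.curve.clearedEval 3 d.xNum * d.unitSeries ^ 2 with hP
  have hT0 := d.constantCoeff_isogParam
  have hP0 : constantCoeff P = 1 := by
    rw [hP, map_mul, map_pow, d.constantCoeff_unitSeries, one_pow, mul_one,
      d.curve.constantCoeff_clearedEval d.natDegree_xNum_le, coeff_xNum_three]
  have hηlem := d.isogCurve.formalEta_subst_mul_eq hT0 hP0 d.sq_imagePoint
  rw [isogCurve_a₁, isogCurve_a₃] at hηlem
  simp only [map_zero, zero_mul, zero_sub, add_zero] at hηlem
  have hV2 : d.curve.formalEta * (T * d⁄dX R P - 2 * P * d⁄dX R T) = -2 * C d.piConst * P := by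
    have h := formalEta_mul_velu_image_scaled (W := d.curve) (p := 3) (n := 1) (-d.yi) (by norm_num)
      d.natDegree_kernelPoly_le d.natDegree_xNum_le d.natDegree_yNum_le d.coeff_yNum_three d.omega
    rw [← unitSeries, ← isogParam, ← hP, ← hT] at h
    rw [h, piConst, Nat.cast_ofNat, show ((3 : R) * -d.yi) = -3 * d.yi by ring]
  have hsT : HasSubst T := HasSubst.of_constantCoeff_zero' hT0
  set Z := T * d⁄dX R P - 2 * P * d⁄dX R T with hZ
  have hZ0 : constantCoeff Z = -(2 * d.piConst) := by
    rw [hZ, map_sub, map_mul, hT0, zero_mul, zero_sub, map_mul, map_mul, hP0, mul_one,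
      ← coeff_zero_eq_constantCoeff_apply (d⁄dX R _), coeff_derivative, zero_add, Nat.cast_zero, zero_add,
      mul_one, coeff_one_isogParam, map_ofNat]
  have hZu : IsUnit Z := by
    rw [isUnit_iff_constantCoeff, hZ0, IsUnit.neg_iff]
    exact d.isUnit_two.mul (d.isUnit_piConst h3)
  have hηform : C d.piConst * d.isogCurve.formalEta.subst T = d.curve.formalEta * d⁄dX R T := by
    have h1 : Z * (C d.piConst * d.isogCurve.formalEta.subst T - d.curve.formalEta * d⁄dX R T) = 0 := by
      linear_combination C d.piConst * hηlem - d⁄dX R T * hV2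
    exact sub_eq_zero.mp (hZu.mul_right_eq_zero.mp h1)
  have hηW' : d.isogCurve.formalEta.subst T * d.isogCurve.formalInvDiff.subst T = 1 := by
    rw [← subst_mul hsT, d.isogCurve.formalEta_mul_formalInvDiff, one_subst hsT]
  have hηW := d.curve.formalEta_mul_formalInvDiff
  linear_combination (-(d.isogCurve.formalInvDiff.subst T * d.curve.formalInvDiff)) * hηform +
    (C d.piConst * d.curve.formalInvDiff) * hηW' - (d.isogCurve.formalInvDiff.subst T * d⁄dX R T) * hηW

/-- **`X'(T)` in the pole-free Vélu + Lemma 10 form** (hypothesis `hV` of the tree's `formalXReg_rel_of_velu`):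
with `N = ev₁(X - x(P))`, `X'(T) = (3XN² + 2(zηη' - η²)N² - z²(N·D²N - (DN)²) - T₀z²N²)·u²` — from
`X'(T) = ev₃(U)u²`, the Kohel form of `U` and the tree's `clearedEval_logForm`. [cite: BlakestadGrant2023, Prop. 13] -/
theorem formalXMulSq_isogCurve_subst_eq_logForm :
    d.isogCurve.formalXMulSq.subst d.isogParam =
      ((3 : R⟦X⟧) * d.curve.formalXMulSq * d.curve.clearedEval 1 (Polynomial.X - Polynomial.C (d.Y * th)) ^ 2 +
        ((3 : R⟦X⟧) - 1) * (X * d.curve.formalEta * d⁄dX R d.curve.formalEta - d.curve.formalEta ^ 2) *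
          d.curve.clearedEval 1 (Polynomial.X - Polynomial.C (d.Y * th)) ^ 2 -
        X ^ 2 * logDeriv₂Num d.curve.formalInvariantDerivation (d.curve.clearedEval 1 (Polynomial.X - Polynomial.C (d.Y * th))) -
        C d.T0 * X ^ 2 * d.curve.clearedEval 1 (Polynomial.X - Polynomial.C (d.Y * th)) ^ 2) * d.unitSeries ^ 2 := by
  set D : R[X] := Polynomial.X - Polynomial.C (d.Y * th) with hD
  have hDn : D.natDegree ≤ 1 := by
    rw [hD]; refine (Polynomial.natDegree_sub_le _ _).trans (max_le Polynomial.natDegree_X_le ?_)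
    rw [Polynomial.natDegree_C]; exact Nat.zero_le _
  -- `U = Y⁻²Ũ = (3X - T₀)D² - 𝓛(D)`
  have hY2 : d.yi ^ 2 * d.Y ^ 2 = 1 := by linear_combination (d.Y * d.yi + 1) * d.Y_mul_yi
  have hU : d.xNum = (Polynomial.C (((2 * 1 + 1 : ℕ) : R)) * Polynomial.X - Polynomial.C d.T0) * D ^ 2 -
      d.curve.veluLogOp D := by
    rw [xNum, d.kohel h3, ← mul_assoc, ← Polynomial.C_mul, hY2, Polynomial.C_1, one_mul, ← hD]
    norm_num
  have hevU := d.curve.clearedEval_logForm (n := 1) le_rfl hDn hU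
  rw [formalXMulSq_isogCurve_subst, hevU]
  push_cast
  ring

/-- **Blakestad–Grant's Prop. 13 hypothesis in `ρ`-form for the canonical `3`-isogeny**:
`(π²·ρ'(T) - 3·ρ + T₀)·u² = u·D²u - (Du)²` (`ρ = x + D(Dz/z)` the regular part of `x`, tree `formalXReg`) —
by the tree's `formalXReg_rel_of_velu` from `T = πtNu`, `ω'(T)dT = πω` and the Vélu form of `X'(T)`.
This is the input of `zetaTilde_isogeny_rel_of_formalXReg_rel` (Prop. 13(a)) and hence of Dwork's lemma
(`coeff_exp_sigmaExpArg_mem_of_isogeny`). [cite: BlakestadGrant2023, Prop. 13] -/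
theorem formalXReg_rel :
    (C (d.piConst ^ 2) * d.isogCurve.formalXReg.subst d.isogParam - (3 : R⟦X⟧) * d.curve.formalXReg + C d.T0) *
        d.unitSeries ^ 2 = logDeriv₂Num d.curve.formalInvariantDerivation d.unitSeries := by
  have hN0 : constantCoeff (d.curve.clearedEval 1 (Polynomial.X - Polynomial.C (d.Y * th))) = 1 := by
    have hDn : (Polynomial.X - Polynomial.C (d.Y * th) : R[X]).natDegree ≤ 1 := by
      refine (Polynomial.natDegree_sub_le _ _).trans (max_le Polynomial.natDegree_X_le ?_)
      rw [Polynomial.natDegree_C]; exact Nat.zero_le _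
    rw [d.curve.constantCoeff_clearedEval hDn, Polynomial.coeff_sub, Polynomial.coeff_X_one, Polynomial.coeff_C,
      if_neg one_ne_zero, sub_zero]
  have h := WeierstrassCurve.formalXReg_rel_of_velu (W := d.curve) (W' := d.isogCurve) 3 (d.isUnit_piConst h3) hN0
    d.constantCoeff_unitSeries (d.isogParam_eq h3) (d.formalInvDiff_isogCurve_subst h3)
    (d.formalXMulSq_isogCurve_subst_eq_logForm h3)
  exact_mod_cast h

end Third

end Chart

end Summit.BirchSwinnertonDyer.Rank1Residual.X1.PadicSigmaThree

end
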